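import Summits.KontsevichZagierPeriods.KontsevichZagierPeriods.Theorems.TerasomaMultiplicationReflectionThirdMovesTwo

/-!
# `ReflectionThird` (stmt-KontsevichZagierPeriods-12307) — Euler reflection at `1/3` as a move chain

Route `TerasomaMultiplication`, support item #9: for every representation
`r = [(0,1), sin(π/3)·x^{-2/3}(1-x)^{-1/3}]` and every `p = [closed unit disc, 1]`,
`KZ.Equivalent r p` — the instance `a = 1/3` of Euler's reflection formula
`B(a,1-a)·sin(πa) = π` INSIDE the Kontsevich–Zagier calculus of moves (no Γ-function identity is
used: every step is a rule-1/2/3 move of `KZCalculus.lean`).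

This file supplies the first move (rule 2, `x = u³/(1+u³)`, which makes the integrand rational:
`sin(π/3) x^{-2/3}(1-x)^{-1/3} dx = 3 sin(π/3) du/(1+u³)`) and assembles the chain of
`…ReflectionThirdReps.lean` / `…ReflectionThirdMoves(Two).lean` with the tree's
`invSqrtRep ∼ piRep` (`Theorems/BetaCancellation/Negative/PiLink.lean`).

References: M. Kontsevich, D. Zagier, *Periods* (2001), §1.1–1.2; G. Andrews, R. Askey, R. Roy,
*Special Functions* (1999), Thm. 1.2.1, §1.2.
-/

noncomputable section

set_option linter.dupNamespace false

open MeasureTheory Set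
open Literature.NumberTheory.Transcendental
open Literature.NumberTheory.Transcendental.KZ
open Literature.ModelTheory.ExponentialFields (IsSemialgebraic isSemialgebraic_univ)
open MvPolynomial (aeval X C)
open Literature.NumberTheory.Transcendental.KZreg (unitIoo isSemialgebraic_unitIoo)
open Summit.KontsevichZagierPeriods.KontsevichZagierPeriods.BetaCancellationNegative
  (symIoo invSqrtRep equivalent_invSqrtRep_twoSqrtRep equivalent_twoSqrtRep_piRep)
open Summit.KontsevichZagierPeriods.HermiteRigidity.GenusTwoCycleTransfer
  (hasFDerivAt_fin_one det_smul_id_fin_one)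

namespace Summit.KontsevichZagierPeriods.KontsevichZagierPeriods.Theorems

namespace ReflectionThird

/-- `k = 3 sin(π/3)`. [folklore] -/
theorem k3_eq_three_mul_sin : k3 = 3 * Real.sin (Real.pi / 3) := by
  rw [Real.sin_pi_div_three, k3]
  ring

/-! ### Move 1 (rule 2): `x = u³/(1+u³)` from `(0,∞)` onto `(0,1)` -/

/-- `d/du u³/(1+u³) = 3u²/(1+u³)²` for `u > 0`. [folklore] -/
theorem hasDerivAt_cubeFun {u : ℝ} (hu : 0 < u) : HasDerivAt cubeFun (cubeFunDeriv u) u := by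
  have hA := one_add_cube_pos hu
  have hp3 : HasDerivAt (fun s : ℝ => s ^ 3) (3 * u ^ 2) u := by
    simpa using hasDerivAt_pow 3 u
  have hg : HasDerivAt (fun s : ℝ => 1 + s ^ 3) (3 * u ^ 2) u := by
    simpa using (hasDerivAt_pow 3 u).const_add 1
  have h := hp3.div hg hA.ne'
  refine h.congr_deriv ?_
  rw [cubeFunDeriv, div_eq_div_iff (pow_ne_zero 2 hA.ne') (pow_ne_zero 2 hA.ne')]
  ring

/-- `0 < 3u²/(1+u³)²` for `u > 0`. [folklore] -/
theorem cubeFunDeriv_pos {u : ℝ} (hu : 0 < u) : 0 < cubeFunDeriv u := by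
  have hA := one_add_cube_pos hu
  unfold cubeFunDeriv
  positivity

/-- `u³/(1+u³) ∈ (0,1)` for `u > 0`. [folklore] -/
theorem cubeFun_mem_unitIoo {u : ℝ} (hu : 0 < u) : (fun _ : Fin 1 => cubeFun u) ∈ unitIoo := by
  have hA := one_add_cube_pos hu
  refine ⟨div_pos (pow_pos hu 3) hA, (div_lt_one hA).2 (by linarith)⟩

/-- `1 - u³/(1+u³) = (1+u³)⁻¹`. [folklore] -/
theorem one_sub_cubeFun {u : ℝ} (hu : 0 < u) : 1 - cubeFun u = (1 + u ^ 3)⁻¹ := by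
  have hA := one_add_cube_pos hu
  rw [cubeFun, inv_eq_one_div, eq_div_iff hA.ne', sub_mul, div_mul_cancel₀ _ hA.ne']
  ring

/-- `u ↦ u³/(1+u³)` is injective on `(0,∞)`. [folklore] -/
theorem injOn_cubeFun : InjOn cubeFun (Ioi 0) := by
  intro u hu v hv h
  have hu' : (0:ℝ) < u := hu
  have hv' : (0:ℝ) < v := hv
  have hA := one_add_cube_pos hu'
  have hB := one_add_cube_pos hv'
  rw [cubeFun, cubeFun, div_eq_div_iff hA.ne' hB.ne'] at h
  have h3 : u ^ 3 = v ^ 3 := by linear_combination h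
  exact (pow_left_inj₀ hu'.le hv'.le (by norm_num : (3:ℕ) ≠ 0)).1 h3

/-- `cubeMap` sends `(0,∞)` onto `(0,1)` (preimage of `y` is `(y/(1-y))^{1/3}`). [folklore] -/
theorem image_cubeMap_posDom : cubeMap '' posDom = unitIoo := by
  ext y
  constructor
  · rintro ⟨x, hx, rfl⟩
    exact cubeFun_mem_unitIoo hx
  · intro hy
    rw [mem_unitIoo'] at hy
    have h1 : 0 < 1 - y 0 := by linarith [hy.2]
    set a : ℝ := y 0 / (1 - y 0) with ha_def
    have ha : 0 < a := div_pos hy.1 h1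
    set u : ℝ := a ^ ((1:ℝ) / 3) with hu_def
    have hu : 0 < u := Real.rpow_pos_of_pos ha _
    have hu3 : u ^ 3 = a := by
      rw [hu_def, ← Real.rpow_natCast, ← Real.rpow_mul ha.le]
      norm_num
    refine ⟨fun _ => u, hu, eq_of_apply_zero_eq ?_⟩
    simp only [cubeMap, cubeFun, hu3, ha_def]
    field_simp
    ring

/-- **The Jacobian identity of move 1**:
`(u³/(1+u³))^{-2/3} · (1 - u³/(1+u³))^{-1/3} · 3u²/(1+u³)² = 3/(1+u³)` for `u > 0`. [folklore] -/
theorem cube_jacobian {u : ℝ} (hu : 0 < u) :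
    cubeFun u ^ (-(2:ℝ) / 3) * (1 - cubeFun u) ^ (-(1:ℝ) / 3) * cubeFunDeriv u = 3 / (1 + u ^ 3) := by
  have hA : 0 < 1 + u ^ 3 := one_add_cube_pos hu
  have hx3 : (u ^ 3) ^ (-(2:ℝ) / 3) = (u ^ 2)⁻¹ := by
    rw [← Real.rpow_natCast u 3, ← Real.rpow_mul hu.le, neg_div, mul_neg, Real.rpow_neg hu.le,
      ← Real.rpow_natCast u 2]
    norm_num
  have hA23 : (1 + u ^ 3) ^ (-(2:ℝ) / 3) = ((1 + u ^ 3) ^ ((2:ℝ) / 3))⁻¹ := by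
    rw [neg_div, Real.rpow_neg hA.le]
  have hA13 : ((1 + u ^ 3)⁻¹) ^ (-(1:ℝ) / 3) = (1 + u ^ 3) ^ ((1:ℝ) / 3) := by
    rw [Real.inv_rpow hA.le, neg_div, Real.rpow_neg hA.le, inv_inv]
  have hsum : (1 + u ^ 3) ^ ((2:ℝ) / 3) * (1 + u ^ 3) ^ ((1:ℝ) / 3) = 1 + u ^ 3 := by
    rw [← Real.rpow_add hA]
    norm_num
  rw [one_sub_cubeFun hu, cubeFun, Real.div_rpow (pow_nonneg hu.le 3) hA.le, hx3, hA23, hA13,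
    cubeFunDeriv, div_inv_eq_mul]
  have hu2 : (u ^ 2)⁻¹ * u ^ 2 = 1 := inv_mul_cancel₀ (pow_ne_zero 2 hu.ne')
  calc (u ^ 2)⁻¹ * (1 + u ^ 3) ^ ((2:ℝ) / 3) * (1 + u ^ 3) ^ ((1:ℝ) / 3) *
        (3 * u ^ 2 / (1 + u ^ 3) ^ 2)
      = ((u ^ 2)⁻¹ * u ^ 2) * ((1 + u ^ 3) ^ ((2:ℝ) / 3) * (1 + u ^ 3) ^ ((1:ℝ) / 3)) * 3 /
          (1 + u ^ 3) ^ 2 := by ring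
    _ = 1 * (1 + u ^ 3) * 3 / (1 + u ^ 3) ^ 2 := by rw [hu2, hsum]
    _ = 3 / (1 + u ^ 3) := by field_simp

/-- **Move 1**: for every representation `r` on `(0,1)` with integrand
`sin(π/3)·x^{-2/3}(1-x)^{-1/3}` there, `[(0,∞), k/(1+u³)] − [r]` is ONE change-of-variables move
(`x = u³/(1+u³)`, `k = 3 sin(π/3)`). [cite: AndrewsAskeyRoy1999, §1.2] -/
theorem cubeRep_sub_mem (r : IntegralRep 1) (hd : r.domain = {x | x 0 ∈ Set.Ioo (0:ℝ) 1})
    (hi : Set.EqOn r.integrand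
      (fun x => Real.sin (Real.pi / 3) * (x 0) ^ (-(2:ℝ) / 3) * (1 - x 0) ^ (-(1:ℝ) / 3)) r.domain) :
    of cubeRep - of r ∈ changeOfVariablesRel := by
  have hd' : r.domain = unitIoo := hd.trans setOf_mem_Ioo_eq_unitIoo
  refine ⟨1, cubeRep, r, cubeMap, cubeMapDeriv, ?_, ?_, ?_, ?_, ?_, rfl⟩
  · refine IsSemialgebraicMapOn.of_forall isSemialgebraic_posDom fun _ => ?_
    refine (isSemialgebraicFunOn_aeval_div_aeval isSemialgebraic_posDom
      (X 0 ^ 3 : MvPolynomial (Fin 1) ℚ) (1 + X 0 ^ 3) fun x hx => ?_).congr fun x _ => ?_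
    · simp only [mem_posDom] at hx
      simp only [map_add, map_one, map_pow, MvPolynomial.aeval_X]
      exact (one_add_cube_pos hx).ne'
    · simp [cubeMap, cubeFun]
  · intro x hx
    simp only [cubeRep_domain, mem_posDom] at hx
    exact (hasFDerivAt_fin_one cubeFun _ x (hasDerivAt_cubeFun hx)).hasFDerivWithinAt
  · intro x hx y hy h
    have h0 : cubeFun (x 0) = cubeFun (y 0) := congrFun h 0
    exact eq_of_apply_zero_eq (injOn_cubeFun hx hy h0)
  · rw [hd', cubeRep_domain, image_cubeMap_posDom]
  · intro x hx
    simp only [cubeRep_domain, mem_posDom] at hx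
    have hmem : cubeMap x ∈ r.domain := by
      rw [hd']
      exact cubeFun_mem_unitIoo hx
    rw [hi hmem, cubeMapDeriv, abs_det_smul_id, abs_of_pos (cubeFunDeriv_pos hx)]
    simp only [cubeRep_integrand, cubeMap]
    rw [k3_eq_three_mul_sin]
    have key := cube_jacobian hx
    calc 3 * Real.sin (Real.pi / 3) / (1 + x 0 ^ 3)
        = Real.sin (Real.pi / 3) * (3 / (1 + x 0 ^ 3)) := by ring
      _ = Real.sin (Real.pi / 3) * (cubeFun (x 0) ^ (-(2:ℝ) / 3) *
            (1 - cubeFun (x 0)) ^ (-(1:ℝ) / 3) * cubeFunDeriv (x 0)) := by rw [key]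
      _ = Real.sin (Real.pi / 3) * cubeFun (x 0) ^ (-(2:ℝ) / 3) *
            (1 - cubeFun (x 0)) ^ (-(1:ℝ) / 3) * cubeFunDeriv (x 0) := by ring

/-! ### The last link: `piRep ∼ p` for every `p = [closed unit disc, 1]` -/

/-- Any representation with the disc as domain and integrand `1` on it differs from `piRep` by
a relation (congruence). [cite: KontsevichZagier2001, §1.1 eq. (1)] -/
theorem piRep_sub_mem (p : IntegralRep 2) (hp : p.domain = {z | z 0 ^ 2 + z 1 ^ 2 ≤ 1})
    (hpi : Set.EqOn p.integrand (fun _ => 1) p.domain) : of piRep - of p ∈ relations := by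
  refine of_sub_of_mem_relations_of_eqOn (by rw [hp]; rfl) fun z hz => ?_
  have hz' : z ∈ p.domain := by
    rw [hp]
    exact hz
  rw [piRep_integrand, hpi hz']

end ReflectionThird

open ReflectionThird

/-- **`ReflectionThird` (item stmt-KontsevichZagierPeriods-12307 of route TerasomaMultiplication)**:
Euler's reflection formula at `a = 1/3`, `sin(π/3)·B(1/3,2/3) = π`, as a chain of Kontsevich–Zagier
moves: for every `r = [(0,1), sin(π/3) x^{-2/3}(1-x)^{-1/3}]` and every `p = [{x²+y² ≤ 1}, 1]`,
`r ∼ p`. The chain: `x = u³/(1+u³)` (rule 2) to `[(0,∞), k/(1+u³)]`, `k = 3 sin(π/3) = 3√3/2`;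
split at `u = 1` (rule 1) and fold `(1,∞)` onto `(0,1)` by `v = 1/u` (rule 2); recombine the two
integrands `k/(1+v³) + kv/(1+v³) = k/(v²-v+1)` (rule 1, the logarithmic parts cancel identically);
`t = (2v-1)/√3` (rule 2) to `[{3t²<1}, 3/(1+t²)]`; the tripling map `T = (3t-t³)/(1-3t²)` (rule 2)
to `[ℝ, 1/(1+T²)]`; `x = T/√(1+T²)` (rule 2) to `[(-1,1), 1/√(1-x²)]`; and Kontsevich–Zagier's own
§1.1 example `∫ dx/√(1-x²) = ∫ 2√(1-x²) dx = ∬_{disc} 1` (in the tree).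
[cite: AndrewsAskeyRoy1999, Thm. 1.2.1] -/
theorem reflectionThird_proof :
    Summit.KontsevichZagierPeriods.KontsevichZagierPeriods.Theses.TerasomaMultiplication.ReflectionThird := by
  intro r p hd hi hp hpi
  have h1 : of cubeRep - of r ∈ relations :=
    changeOfVariablesRel_subset_relations (cubeRep_sub_mem r hd hi)
  have h2 : of cubeRep - of cubeRepUnit - of cubeRepIci ∈ relations :=
    domainAddRel_subset_relations cubeRep_sub_sub_mem
  have h3 : of cubeRepIci - of foldRep ∈ relations :=
    changeOfVariablesRel_subset_relations cubeRepIci_sub_foldRep_mem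
  have h4 : of foldRep - of foldRepUnit ∈ relations := foldRep_sub_foldRepUnit_mem
  have h5 : of quadRep - of cubeRepUnit - of foldRepUnit ∈ relations :=
    integrandAddRel_subset_relations quadRep_sub_sub_mem
  have h6 : of quadRep - of arcRep ∈ relations :=
    changeOfVariablesRel_subset_relations quadRep_sub_arcRep_mem
  have h7 : of arcRep - of lineRep ∈ relations :=
    changeOfVariablesRel_subset_relations arcRep_sub_lineRep_mem
  have h8 : of lineRep - of invSqrtRep ∈ relations :=
    changeOfVariablesRel_subset_relations lineRep_sub_invSqrtRep_mem
  have h9 : of invSqrtRep - of piRep ∈ relations :=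
    equivalent_invSqrtRep_twoSqrtRep.trans equivalent_twoSqrtRep_piRep
  have h10 : of piRep - of p ∈ relations := piRep_sub_mem p hp hpi
  have key : of r - of p = -(of cubeRep - of r) + (of cubeRep - of cubeRepUnit - of cubeRepIci) +
      (of cubeRepIci - of foldRep) + (of foldRep - of foldRepUnit) -
      (of quadRep - of cubeRepUnit - of foldRepUnit) + (of quadRep - of arcRep) +
      (of arcRep - of lineRep) + (of lineRep - of invSqrtRep) + (of invSqrtRep - of piRep) +
      (of piRep - of p) := by abel
  show of r - of p ∈ relations
  rw [key]
  exact relations.add_mem (relations.add_mem (relations.add_mem (relations.add_mem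
    (relations.sub_mem (relations.add_mem (relations.add_mem (relations.add_mem
    (relations.neg_mem h1) h2) h3) h4) h5) h6) h7) h8) h9 |> fun h => relations.add_mem h h10

/-- Sanity check by soundness: every such `r` represents `π` — the value identity
`sin(π/3)·B(1/3,2/3) = π` read off the move chain (`KZ.Equivalent.value_eq_holds`) and
`KZ.piRep_value`, with no Γ-function input. [cite: AndrewsAskeyRoy1999, Thm. 1.2.1] -/
theorem reflectionThird_value_eq_pi (r : IntegralRep 1)
    (hd : r.domain = {x | x 0 ∈ Set.Ioo (0:ℝ) 1})
    (hi : Set.EqOn r.integrand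
      (fun x => Real.sin (Real.pi / 3) * (x 0) ^ (-(2:ℝ) / 3) * (1 - x 0) ^ (-(1:ℝ) / 3)) r.domain) :
    r.value = Real.pi := by
  rw [← piRep_value]
  exact Equivalent.value_eq_holds (reflectionThird_proof r piRep hd hi rfl fun _ _ => rfl)

end Summit.KontsevichZagierPeriods.KontsevichZagierPeriods.Theorems

end
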